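import Summits.CriticalPhenomena.PercolationContinuityZ3.Theorems.PercNearOneGluingNoHeavyLowerTailSahiCombTriWAndProd
import Summits.CriticalPhenomena.PercolationContinuityZ3.Theorems.PercNearOneGluingNoHeavyLowerTailSahiCombTriWRelabel

/-!
# `Cor` is transported by relabeling, and the AND-product is symmetric: `P₁ ∧ Q ≅ Q ∧ P₁`

Support file of the one-cut programme (crux `NoHeavyLowerTail`, stmt-CriticalPhenomena-4575; unit `prim-lf-1` gen 58, memo
`FROM-prim-lf-1-gen58-Q311-LEAN-AND-PROFILE-NOGO.md` §8(a)).  Bookkeeping that the block-theorem files (`…TriWAndMaj3`, `…AndClaw*`,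
`…AndPerfect4`, `…AndQ311`, …) leave implicit: they all prove "`P₁ ∧ Q` has `Cor ≥ 0` for EVERY good `P₁`" with the block `Q` on the RIGHT.
Since the swap `γ₁ ⊕ γ₂ ≃ γ₂ ⊕ γ₁` carries `andProd P₁ Q` to `andProd Q P₁` and `Cor` is invariant under relabeling, every such theorem also
holds with the block on the LEFT; in particular (II) — "`P ∧ Q` good for all good `P`, `Q`" — is symmetric in the two factors, and for a block
`Q` the partners `P` not already covered by a landed theorem are exactly those to which no landed block theorem applies on EITHER side
(e.g. for the open five-variable blocks: partners with at least five essential variables).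
* `corP_famMap` : `Cor_{e P}(e A, e B) = Cor_P(A, B)`;  `corP_nonneg_famMap_iff` : "`Cor ≥ 0` on all pairs of up-sets" is transported;
* `famMap_sumComm_andProd` : `famMap (Equiv.sumComm γ₁ γ₂) (andProd P₁ Q) = andProd Q P₁`;
* `corP_andProd_comm_nonneg_iff` : `Cor_{P₁∧Q} ≥ 0` on all pairs of up-sets ⟺ `Cor_{Q∧P₁} ≥ 0` on all pairs of up-sets;
* `disjoint_andProd_refl_comm`, example: `perfect4 ∧ P₁`-type statements from the right-handed theorems (`corP_andProd_nonneg_symm`).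
HONEST LABEL: pure bookkeeping, complete proofs, std axioms. [this work]
-/

namespace Summit.CriticalPhenomena.PercolationContinuityZ3.Theorems

namespace FiveUpSet

open Finset

variable {γ δ γ₁ γ₂ : Type} [DecidableEq γ] [Fintype γ] [DecidableEq δ] [Fintype δ] [DecidableEq γ₁] [Fintype γ₁] [DecidableEq γ₂] [Fintype γ₂]

/-! ### `Cor` under relabeling -/

/-- **`Cor` is invariant under relabeling of the ground set**: `Cor_{e P}(e A, e B) = Cor_P(A, B)`. [this work] -/
theorem corP_famMap (e : γ ≃ δ) (P A B : Finset (Finset γ)) : corP (famMap e P) (famMap e A) (famMap e B) = corP P A B := by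
  unfold corP
  rw [refl_famMap, refl_famMap, card_famMap_inter₃, card_famMap_inter₃, card_famMap_inter₃, card_famMap_inter₃]

/-- "`Cor_P ≥ 0` on all pairs of up-sets" is transported along a relabeling. [this work] -/
theorem corP_nonneg_famMap {e : γ ≃ δ} {P : Finset (Finset γ)}
    (h : ∀ A B : Finset (Finset γ), IsUpperSet (A : Set (Finset γ)) → IsUpperSet (B : Set (Finset γ)) → 0 ≤ corP P A B)
    (A B : Finset (Finset δ)) (hA : IsUpperSet (A : Set (Finset δ))) (hB : IsUpperSet (B : Set (Finset δ))) :
    0 ≤ corP (famMap e P) A B := by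
  have h' := h (famMap e.symm A) (famMap e.symm B) (isUpperSet_famMap e.symm hA) (isUpperSet_famMap e.symm hB)
  rwa [← corP_famMap e, famMap_famMap_symm, famMap_famMap_symm] at h'

/-- The transport as an equivalence. [this work] -/
theorem corP_nonneg_famMap_iff (e : γ ≃ δ) (P : Finset (Finset γ)) :
    (∀ A B : Finset (Finset δ), IsUpperSet (A : Set (Finset δ)) → IsUpperSet (B : Set (Finset δ)) → 0 ≤ corP (famMap e P) A B) ↔
    (∀ A B : Finset (Finset γ), IsUpperSet (A : Set (Finset γ)) → IsUpperSet (B : Set (Finset γ)) → 0 ≤ corP P A B) := by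
  constructor
  · intro h A B hA hB
    have h' := corP_nonneg_famMap (e := e.symm) h A B hA hB
    rwa [famMap_symm_famMap] at h'
  · intro h A B hA hB
    exact corP_nonneg_famMap h A B hA hB

/-- Antipode-freeness is transported along a relabeling. [this work] -/
theorem disjoint_refl_famMap (e : γ ≃ δ) {P : Finset (Finset γ)} (hd : Disjoint P (refl P)) : Disjoint (famMap e P) (refl (famMap e P)) := by
  rw [refl_famMap, disjoint_iff_inter_eq_empty, ← famMap_inter, disjoint_iff_inter_eq_empty.1 hd]
  rfl

/-! ### The swap `γ₁ ⊕ γ₂ ≃ γ₂ ⊕ γ₁` and the symmetry of the AND-product -/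

/-- **The AND-product is symmetric up to the swap of the blocks**: `famMap (sumComm) (P₁ ∧ Q) = Q ∧ P₁`. [this work] -/
theorem famMap_sumComm_andProd (P₁ : Finset (Finset γ₁)) (Q : Finset (Finset γ₂)) :
    famMap (Equiv.sumComm γ₁ γ₂) (andProd P₁ Q) = andProd Q P₁ := by
  ext s
  rw [mem_famMap, mem_andProd, mem_andProd]
  have h1 : (s.map (Equiv.sumComm γ₁ γ₂).symm.toEmbedding).toLeft = s.toRight := by
    rw [Equiv.sumComm_symm]; exact toLeft_map_sumComm
  have h2 : (s.map (Equiv.sumComm γ₁ γ₂).symm.toEmbedding).toRight = s.toLeft := by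
    rw [Equiv.sumComm_symm]; exact toRight_map_sumComm
  rw [h1, h2]
  exact and_comm

/-- **(II) is symmetric in the two factors**: `Cor_{P₁ ∧ Q} ≥ 0` on all pairs of up-sets iff `Cor_{Q ∧ P₁} ≥ 0` on all pairs of up-sets. [this work] -/
theorem corP_andProd_comm_nonneg_iff (P₁ : Finset (Finset γ₁)) (Q : Finset (Finset γ₂)) :
    (∀ A B : Finset (Finset (γ₁ ⊕ γ₂)), IsUpperSet (A : Set (Finset (γ₁ ⊕ γ₂))) → IsUpperSet (B : Set (Finset (γ₁ ⊕ γ₂))) →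
        0 ≤ corP (andProd P₁ Q) A B) ↔
    (∀ A B : Finset (Finset (γ₂ ⊕ γ₁)), IsUpperSet (A : Set (Finset (γ₂ ⊕ γ₁))) → IsUpperSet (B : Set (Finset (γ₂ ⊕ γ₁))) →
        0 ≤ corP (andProd Q P₁) A B) := by
  rw [← famMap_sumComm_andProd P₁ Q, corP_nonneg_famMap_iff]

/-- Antipode-freeness of `Q ∧ P₁` from that of `P₁ ∧ Q`. [this work] -/
theorem disjoint_andProd_refl_comm {P₁ : Finset (Finset γ₁)} {Q : Finset (Finset γ₂)}
    (hd : Disjoint (andProd P₁ Q) (refl (andProd P₁ Q))) : Disjoint (andProd Q P₁) (refl (andProd Q P₁)) := by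
  have h := disjoint_refl_famMap (Equiv.sumComm γ₁ γ₂) hd
  rwa [famMap_sumComm_andProd] at h

/-- **Using a right-handed block theorem on the left.**  If a block `Q` satisfies "`P₁ ∧ Q` has `Cor ≥ 0` for every antipode-free up-set `P₁` with
`Cor_{P₁} ≥ 0`" (the shape of every `…TriWAnd*` block theorem), then also `Q ∧ P₁` has `Cor ≥ 0` for every such `P₁`. [this work] -/
theorem corP_andProd_nonneg_symm {Q : Finset (Finset γ₂)}
    (hQ : ∀ {γ₁ : Type} [DecidableEq γ₁] [Fintype γ₁] {P₁ : Finset (Finset γ₁)}, IsUpperSet (P₁ : Set (Finset γ₁)) → Disjoint P₁ (refl P₁) →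
      (∀ U V : Finset (Finset γ₁), IsUpperSet (U : Set (Finset γ₁)) → IsUpperSet (V : Set (Finset γ₁)) → 0 ≤ corP P₁ U V) →
      ∀ A B : Finset (Finset (γ₁ ⊕ γ₂)), IsUpperSet (A : Set (Finset (γ₁ ⊕ γ₂))) → IsUpperSet (B : Set (Finset (γ₁ ⊕ γ₂))) →
        0 ≤ corP (andProd P₁ Q) A B)
    {P₁ : Finset (Finset γ₁)} (hP : IsUpperSet (P₁ : Set (Finset γ₁))) (hd : Disjoint P₁ (refl P₁))
    (hcor : ∀ U V : Finset (Finset γ₁), IsUpperSet (U : Set (Finset γ₁)) → IsUpperSet (V : Set (Finset γ₁)) → 0 ≤ corP P₁ U V)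
    (A B : Finset (Finset (γ₂ ⊕ γ₁))) (hA : IsUpperSet (A : Set (Finset (γ₂ ⊕ γ₁)))) (hB : IsUpperSet (B : Set (Finset (γ₂ ⊕ γ₁)))) :
    0 ≤ corP (andProd Q P₁) A B :=
  (corP_andProd_comm_nonneg_iff P₁ Q).1 (hQ hP hd hcor) A B hA hB

end FiveUpSet

end Summit.CriticalPhenomena.PercolationContinuityZ3.Theorems
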